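import Literature.AlgebraicGeometry.HodgeTheory.VHSDataLocallyChartedLift
import Literature.AlgebraicGeometry.HodgeTheory.VHSDataHodgeLocusMeagre
import HarnessLib

/-!
# Over a locally charted one-dimensional base the FULL Hodge locus (all norm bounds at once) is everything-for-some-bound or COUNTABLE

Topic `Literature/AlgebraicGeometry/HodgeTheory` (namespace `Literature.AlgebraicGeometry.Motives.VHSData.IsLocallyCharted`), lane `lit-hodgefound` (seat
`p08`, row g59-#16); the one-dimensional sharpening of `VHSDataHodgeLocusMeagre` (any dimension: the full Hodge locus is everything-for-some-`K` or
MEAGRE) for locally charted variations (`VHSDataLocallyChartedLift` §6: each bounded locus is all of `S` or FINITE), and the chart-side form of the barrier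
file's `CattaniDeligneKaplan1995_hodgeLocus_algebraicFor.exists_eq_univ_or_countable` (which goes through Zariski closedness on a smooth integral curve).
THEOREMS ONLY — no definition, no named fact, no instance (D-0026 net debt `0`).

PRINTED SOURCE, VERBATIM.  E. Cattani, P. Deligne, A. Kaplan, *On the locus of Hodge classes*, J. AMS 8 (1995), §1 (p. 484): «Fix an integer `K` and let
`S^{(K)}` be the space of pairs `(s,u)` with `s ∈ S`, `u ∈ 𝒱_s` integral of type `(0,0)`, and `Q(u,u) ≤ K`. … **Theorem 1.1.** `S^{(K)}` is an algebraic
variety, finite over `S`. **Corollary 1.2.** …»; C. Voisin, *Hodge Theory and Complex Algebraic Geometry II*, §5.3.1 (the components of the Hodge ∕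
Noether–Lefschetz locus are countably many, indexed by the integral classes).  Over a curve: the full locus `{t | ∃ u ≠ 0 integral of type (p,p) at t}`
is the union over `K ∈ ℤ` of the bounded loci, each all of `S` or finite — hence **some bounded locus is all of `S`, or the full locus is COUNTABLE**.

* **`IsLocallyCharted.exists_hodgeLocusOfNormLe_eq_univ_or_countable`** (open ends, compact core), `…_of_compactification` (punctured compact curve),
  `…_of_compactSpace` (compact base, no ends), `…_tensorSpace_…` (`T^{a,b}D`).

## References

* [CattaniDeligneKaplan1995] E. Cattani, P. Deligne, A. Kaplan, *On the locus of Hodge classes*, J. Amer. Math. Soc. 8 (1995) 483–506: §1, Thm. 1.1,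
  Cor. 1.2 (p. 484), 2.3 (p. 487).
* [VoisinHodgeII2003] C. Voisin, *Hodge Theory and Complex Algebraic Geometry II*, CUP (2003), §5.3.1 (Lemma 5.13).
* [Deligne1982HodgeCycles] P. Deligne, *Hodge cycles on abelian varieties*, LNM 900 (1982), I §3, 3.1–3.4 (tensor spaces `T^{a,b}`).
-/

noncomputable section

open scoped TensorProduct
open _root_.Topology _root_.Filter Set

namespace Literature.AlgebraicGeometry

open Motives HodgeTheory Topology

namespace Motives.VHSData

variable {S : Type} [TopologicalSpace S] {k : ℤ} {D : VHSData S k}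
variable {α ι : Type*} {ψ : α → OpenPartialHomeomorph S ℂ} {σ : ι → ℂ → S}

namespace IsLocallyCharted

/-- **Over a locally charted one-dimensional base: SOME bounded Hodge locus is ALL of `S`, OR the FULL Hodge locus `{t | ∃ u ≠ 0 integral of type
(p,p) at t}` is COUNTABLE** — the full locus is `⋃_K hodgeLocusOfNormLe D p K` (the tree's `iUnion_hodgeLocusOfNormLe_eq`) and each bounded locus is
all of `S` or finite (Theorem 1.1 for locally charted variations). [cite: CattaniDeligneKaplan1995, §1, Thm. 1.1, Cor. 1.2 (p. 484)]
[cite: VoisinHodgeII2003, §5.3.1 Lemma 5.13] -/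
theorem exists_hodgeLocusOfNormLe_eq_univ_or_countable [PreconnectedSpace S] (h : D.IsLocallyCharted ψ σ) {p : ℤ} (hpk : p + p = k)
    (hcov : ∀ x : S, ∃ a, x ∈ (ψ a).source) (A : ι → ℝ) (hopen : ∀ (i : ι) (A' : ℝ), A i ≤ A' → IsOpen (σ i '' {z : ℂ | A' < z.im}))
    (hcore : ∀ A' : ι → ℝ, (∀ i, A i ≤ A' i) → ∃ K₀ : Set S, IsCompact K₀ ∧ K₀ ∪ ⋃ i, σ i '' {z : ℂ | A' i < z.im} = univ) :
    (∃ K : ℤ, D.hodgeLocusOfNormLe p K = univ) ∨ {t : S | ∃ u : D.VZ.fiber t, u ≠ 0 ∧ D.IsHodgeAt t p u}.Countable := by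
  by_cases hK : ∃ K : ℤ, D.hodgeLocusOfNormLe p K = univ
  · exact Or.inl hK
  · refine Or.inr ?_
    simp only [not_exists] at hK
    rw [← D.iUnion_hodgeLocusOfNormLe_eq p]
    exact Set.countable_iUnion fun K => ((h.hodgeLocusOfNormLe_eq_univ_or_finite hpk K hcov A hopen hcore).resolve_left (hK K)).countable

variable {X : Type*} [TopologicalSpace X] [CompactSpace X]

/-- **The same over a PUNCTURED COMPACT CURVE** (ends and core from a compactification with disc charts at the punctures).
[cite: CattaniDeligneKaplan1995, Thm. 1.1, Cor. 1.2 (p. 484), 2.3 (p. 487)] [cite: VoisinHodgeII2003, §5.3.1 Lemma 5.13] -/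
theorem exists_hodgeLocusOfNormLe_eq_univ_or_countable_of_compactification [PreconnectedSpace S] (h : D.IsLocallyCharted ψ σ) {p : ℤ}
    (hpk : p + p = k) (hcov : ∀ x : S, ∃ a, x ∈ (ψ a).source) (A : ι → ℝ)
    {j : S → X} (hj : IsEmbedding j) (pt : ι → X) (hpS : ∀ i, pt i ∉ range j) (hcovX : ∀ x : X, x ∉ range j → ∃ i, x = pt i)
    (φ : ι → OpenPartialHomeomorph X ℂ) (hp : ∀ i, pt i ∈ (φ i).source) (hφp : ∀ i, φ i (pt i) = 0)
    (hball : ∀ i, Metric.ball (0 : ℂ) (Real.exp (-(2 * Real.pi * A i))) ⊆ (φ i).target)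
    (hσ : ∀ (i : ι) (z : ℂ), A i < z.im → j (σ i z) = (φ i).symm (Complex.exp (2 * Real.pi * Complex.I * z))) :
    (∃ K : ℤ, D.hodgeLocusOfNormLe p K = univ) ∨ {t : S | ∃ u : D.VZ.fiber t, u ≠ 0 ∧ D.IsHodgeAt t p u}.Countable :=
  h.exists_hodgeLocusOfNormLe_eq_univ_or_countable hpk hcov A (Topology.isOpen_image_ends hj φ A hball σ hσ)
    (Topology.exists_isCompact_core hj pt hpS hcovX φ hp hφp A hball σ hσ)

/-- **The same over a COMPACT base** (no ends). [cite: CattaniDeligneKaplan1995, Thm. 1.1, Cor. 1.2 (p. 484)] [cite: VoisinHodgeII2003, §5.3.1 Lemma 5.13] -/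
theorem exists_hodgeLocusOfNormLe_eq_univ_or_countable_of_compactSpace [CompactSpace S] [PreconnectedSpace S] [IsEmpty ι]
    (h : D.IsLocallyCharted ψ σ) {p : ℤ} (hpk : p + p = k) (hcov : ∀ x : S, ∃ a, x ∈ (ψ a).source) :
    (∃ K : ℤ, D.hodgeLocusOfNormLe p K = univ) ∨ {t : S | ∃ u : D.VZ.fiber t, u ≠ 0 ∧ D.IsHodgeAt t p u}.Countable :=
  h.exists_hodgeLocusOfNormLe_eq_univ_or_countable hpk hcov (fun i => isEmptyElim i) (fun i => isEmptyElim i)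
    fun _ _ => ⟨univ, isCompact_univ, univ_union _⟩

/-- **For every tensor space `T^{a,b}D` of a locally charted `D`**: some bounded Hodge locus of `T^{a,b}D` is all of `S`, or the full locus of nonzero
integral Hodge tensors of type `(p,p)` in `T^{a,b}` is countable. [cite: CattaniDeligneKaplan1995, §1, Thm. 1.1 (p. 484)] [cite: Deligne1982HodgeCycles, I §3, 3.1–3.4] -/
theorem exists_hodgeLocusOfNormLe_tensorSpace_eq_univ_or_countable [PreconnectedSpace S] (h : D.IsLocallyCharted ψ σ) (a b : ℕ) {p : ℤ}
    (hpk : p + p = (a : ℤ) * k + (b : ℤ) * (-k)) (hcov : ∀ x : S, ∃ a, x ∈ (ψ a).source) (A : ι → ℝ)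
    (hopen : ∀ (i : ι) (A' : ℝ), A i ≤ A' → IsOpen (σ i '' {z : ℂ | A' < z.im}))
    (hcore : ∀ A' : ι → ℝ, (∀ i, A i ≤ A' i) → ∃ K₀ : Set S, IsCompact K₀ ∧ K₀ ∪ ⋃ i, σ i '' {z : ℂ | A' i < z.im} = univ) :
    (∃ K : ℤ, (D.tensorSpace a b).hodgeLocusOfNormLe p K = univ) ∨
      {t : S | ∃ u : (D.tensorSpace a b).VZ.fiber t, u ≠ 0 ∧ (D.tensorSpace a b).IsHodgeAt t p u}.Countable :=
  (h.tensorSpace a b).exists_hodgeLocusOfNormLe_eq_univ_or_countable hpk hcov A hopen hcore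

end IsLocallyCharted

end Motives.VHSData

end Literature.AlgebraicGeometry

end
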